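import Mathlib.Analysis.SpecialFunctions.Integrals.Basic
import Mathlib.Analysis.Calculus.MeanValue
import Mathlib.MeasureTheory.Integral.IntervalIntegral.FundThmCalculus
import Mathlib.Analysis.Complex.ExponentialBounds
import HarnessLib

/-!
# Dickman's function `ρ`

Topic `Literature/NumberTheory/Sieve`; a DEFINITION file with a proved API (no named facts). Dickman's function
is the continuous solution of the delay-differential equation `u ρ'(u) = -ρ(u - 1)` (`u > 1`) with
`ρ(u) = 1` for `0 ≤ u ≤ 1` [MontgomeryVaughan2007, §7.1 (7.6)]; it governs `Ψ(x, x^{1/u}) ∼ ρ(u) x`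
(Dickman 1930, op. cit. Thm 7.2) and enters Hildebrand–Tenenbaum's theorems through de Bruijn's
asymptotic [HildebrandTenenbaum1986, (1.5), (2.7)]. Mathlib has no Dickman function (searched: `Dickman`,
delay differential equations — nothing).

We construct `ρ` piecewise: `dickmanPiece n` is `ρ` on `[n, n + 1]`, defined by the integrated equation
`ρ(u) = ρ(n + 1) - ∫_{n+1}^u ρ(v - 1) dv/v` from the previous piece (the harmless `max v 1` in the
denominator keeps every piece continuous on all of `ℝ`), and `dickmanRho u = dickmanPiece ⌊u⌋₊ u`
(so `ρ = 1` on `(-∞, 1]`, a convenient convention).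

* `dickmanRho_of_le_one`, `continuous_dickmanRho`;
* `hasDerivWithinAt_dickmanRho` — `ρ` has right derivative `-ρ(u-1)/u` at every `u ≥ 1`, and
  `hasDerivAt_dickmanRho` at non-integral `u > 1` [MontgomeryVaughan2007, (7.6)];
* `mul_dickmanRho_eq_integral` — **the averaged equation** `u ρ(u) = ∫_{u-1}^u ρ(t) dt` (`u ≥ 1`);
* `dickmanRho_eq_one_sub_log` (`ρ = 1 - log u` on `[1, 2]`), `dickmanRho_pos`, `dickmanRho_antitone`,
  `dickmanRho_le_one`, `dickmanRho_sub_one_le` (`ρ(u - 1) ≤ 4u² ρ(u)`, `u ≥ 1`);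
* `expSubOneDiv` (`g(s) = (e^s - 1)/s`), `strictMonoOn_expSubOneDiv`, `sub_le_two_mul_sub_expSubOneDiv`
  (`g' ≥ 1/2`), and de Bruijn's `dickmanXi` (`e^{ξ(u)} = 1 + u ξ(u)`, `u > 1`
  [HildebrandTenenbaum1986, Thm 2 (ii)]): `exp_dickmanXi`, uniqueness, the stability bound
  `abs_sub_dickmanXi_le` (`|s - ξ(u)| ≤ 2|g(s) - u|`), monotonicity, `log u < ξ(u) ≤ 2 log u`.

## References

* [MontgomeryVaughan2007] H. L. Montgomery, R. C. Vaughan, *Multiplicative Number Theory I*, CUP 2007, §7.1,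
  (7.6) and Thm 7.2 (held: `book:montgomery2007-multiplicative-number-theory-i-classical-theory`, pp. 200–202).
* [HildebrandTenenbaum1986] A. Hildebrand, G. Tenenbaum, Trans. AMS 296 (1986) 265–290, (1.5), (2.7).
-/

noncomputable section

open Real Set Filter MeasureTheory intervalIntegral
open scoped Topology

namespace Literature.NumberTheory.Sieve

/-! ### The pieces and the function -/

/-- `dickmanPiece n` agrees with Dickman's `ρ` on `[n, n + 1]`: `ρ₀ = 1` and
`ρ_{n+1}(u) = ρ_n(n + 1) - ∫_{n+1}^u ρ_n(v - 1)/max(v, 1) dv`. [cite: MontgomeryVaughan2007, §7.1 (7.6)] -/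
def dickmanPiece : ℕ → ℝ → ℝ
  | 0 => fun _ => 1
  | n + 1 => fun u => dickmanPiece n (n + 1) - ∫ v in ((n : ℝ) + 1)..u, dickmanPiece n (v - 1) / max v 1

/-- **Dickman's function** `ρ(u)` (with the convention `ρ(u) = 1` for `u ≤ 1`).
[cite: MontgomeryVaughan2007, §7.1 (7.6)] -/
def dickmanRho (u : ℝ) : ℝ := dickmanPiece ⌊u⌋₊ u

/-- `ρ₀ = 1`. [folklore] -/
@[simp] theorem dickmanPiece_zero (u : ℝ) : dickmanPiece 0 u = 1 := rfl

/-- The recursion defining `ρ_{n+1}`. [cite: MontgomeryVaughan2007, §7.1 (7.6)] -/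
theorem dickmanPiece_succ (n : ℕ) (u : ℝ) :
    dickmanPiece (n + 1) u = dickmanPiece n (n + 1) - ∫ v in ((n : ℝ) + 1)..u, dickmanPiece n (v - 1) / max v 1 :=
  rfl

/-- Consecutive pieces agree at the integer where they meet. [folklore] -/
theorem dickmanPiece_succ_self (n : ℕ) : dickmanPiece (n + 1) (n + 1) = dickmanPiece n (n + 1) := by
  rw [dickmanPiece_succ, intervalIntegral.integral_same, sub_zero]

/-- The integrand of the recursion is continuous when the previous piece is. [folklore] -/
theorem continuous_integrand_of_continuous {f : ℝ → ℝ} (hf : Continuous f) :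
    Continuous fun v : ℝ => f (v - 1) / max v 1 := by
  refine Continuous.div (hf.comp (continuous_sub_right 1)) (continuous_id.max continuous_const) fun v => ?_
  exact ne_of_gt (lt_of_lt_of_le one_pos (le_max_right v 1))

/-- Every piece is continuous on `ℝ`. [folklore] -/
theorem continuous_dickmanPiece : ∀ n : ℕ, Continuous (dickmanPiece n)
  | 0 => continuous_const
  | n + 1 => by
    have hc := continuous_integrand_of_continuous (continuous_dickmanPiece n)
    have hprim := intervalIntegral.continuous_primitive (fun a b => hc.intervalIntegrable (μ := volume) a b)
      ((n : ℝ) + 1)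
    have : dickmanPiece (n + 1) = fun u => dickmanPiece n (n + 1) -
        ∫ v in ((n : ℝ) + 1)..u, dickmanPiece n (v - 1) / max v 1 := rfl
    rw [this]
    exact continuous_const.sub hprim

/-- Each piece is differentiable, `ρ_{n+1}'(u) = -ρ_n(u - 1)/max(u, 1)`. [cite: MontgomeryVaughan2007, (7.6)] -/
theorem hasDerivAt_dickmanPiece_succ (n : ℕ) (u : ℝ) :
    HasDerivAt (dickmanPiece (n + 1)) (-(dickmanPiece n (u - 1) / max u 1)) u := by
  have h := ((continuous_integrand_of_continuous (continuous_dickmanPiece n)).integral_hasStrictDerivAt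
    ((n : ℝ) + 1) u).hasDerivAt
  have h2 : HasDerivAt (fun u => dickmanPiece n (n + 1) - ∫ v in ((n : ℝ) + 1)..u, dickmanPiece n (v - 1) / max v 1)
      (0 - dickmanPiece n (u - 1) / max u 1) u := (hasDerivAt_const u _).sub h
  have : dickmanPiece (n + 1) = fun u => dickmanPiece n (n + 1) -
      ∫ v in ((n : ℝ) + 1)..u, dickmanPiece n (v - 1) / max v 1 := rfl
  rw [this, show -(dickmanPiece n (u - 1) / max u 1) = 0 - dickmanPiece n (u - 1) / max u 1 by ring]
  exact h2

/-- `ρ = ρ_n` on `[n, n + 1]`. [folklore] -/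
theorem dickmanRho_eq_piece {n : ℕ} {u : ℝ} (hu : u ∈ Set.Icc (n : ℝ) (n + 1)) : dickmanRho u = dickmanPiece n u := by
  rcases hu.2.lt_or_eq with h | h
  · have : ⌊u⌋₊ = n := (Nat.floor_eq_iff (le_trans n.cast_nonneg hu.1)).2 ⟨hu.1, h⟩
    rw [dickmanRho, this]
  · have : ⌊u⌋₊ = n + 1 := by
      rw [h, show (n : ℝ) + 1 = ((n + 1 : ℕ) : ℝ) by push_cast; ring, Nat.floor_natCast]
    rw [dickmanRho, this, h]
    exact dickmanPiece_succ_self n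

/-- `ρ(u) = 1` for `u ≤ 1`. [cite: MontgomeryVaughan2007, §7.1] -/
theorem dickmanRho_of_le_one {u : ℝ} (hu : u ≤ 1) : dickmanRho u = 1 := by
  rcases lt_or_ge u 0 with h | h
  · rw [dickmanRho, Nat.floor_of_nonpos h.le]; rfl
  · rw [dickmanRho_eq_piece (n := 0) ⟨by simpa using h, by simpa using hu⟩]; rfl

/-- `ρ(0) = 1`. [cite: MontgomeryVaughan2007, §7.1] -/
@[simp] theorem dickmanRho_zero : dickmanRho 0 = 1 := dickmanRho_of_le_one zero_le_one

/-- `ρ(1) = 1`. [cite: MontgomeryVaughan2007, §7.1] -/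
@[simp] theorem dickmanRho_one : dickmanRho 1 = 1 := dickmanRho_of_le_one le_rfl

/-- `ρ` is continuous. [cite: MontgomeryVaughan2007, §7.1] -/
theorem continuous_dickmanRho : Continuous dickmanRho := by
  rw [continuous_iff_continuousAt]
  intro u
  rcases lt_or_ge u 0 with hu0 | hu0
  · -- `ρ = 1` near `u < 0`
    have : dickmanRho =ᶠ[𝓝 u] fun _ => (1 : ℝ) := by
      filter_upwards [Iio_mem_nhds hu0] with v hv using dickmanRho_of_le_one (le_of_lt (lt_trans hv one_pos))
    exact continuousAt_const.congr this.symm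
  set n : ℕ := ⌊u⌋₊ with hn
  have hnu : (n : ℝ) ≤ u := Nat.floor_le hu0
  have hun : u < n + 1 := Nat.lt_floor_add_one u
  rcases hnu.lt_or_eq with hlt | heq
  · -- interior of `[n, n+1]`: `ρ = ρ_n` near `u`
    have : dickmanRho =ᶠ[𝓝 u] dickmanPiece n := by
      filter_upwards [Ioo_mem_nhds hlt hun] with v hv using dickmanRho_eq_piece ⟨hv.1.le, hv.2.le⟩
    exact (continuous_dickmanPiece n).continuousAt.congr this.symm
  · -- `u = n` an integer: glue `ρ_{n-1}` on the left with `ρ_n` on the right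
    refine continuousAt_iff_continuous_left_right.2 ⟨?_, ?_⟩
    · rcases Nat.eq_zero_or_pos n with hn0 | hnpos
      · have hu' : u = 0 := by rw [← heq, hn0, Nat.cast_zero]
        have : dickmanRho =ᶠ[𝓝[Set.Iic u] u] fun _ => (1 : ℝ) := by
          filter_upwards [self_mem_nhdsWithin] with v hv using
            dickmanRho_of_le_one (le_trans hv (by rw [hu']; norm_num))
        exact continuousAt_const.continuousWithinAt.congr_of_eventuallyEq this (by rw [hu']; simp)
      · obtain ⟨m, hm⟩ : ∃ m, n = m + 1 := ⟨n - 1, by omega⟩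
        have hum : u = (m : ℝ) + 1 := by rw [← heq, hm]; push_cast; ring
        have : dickmanRho =ᶠ[𝓝[Set.Iic u] u] dickmanPiece m := by
          have hmem : Set.Ioc (m : ℝ) u ∈ 𝓝[Set.Iic u] u := Ioc_mem_nhdsLE (by rw [hum]; linarith)
          filter_upwards [hmem] with v hv using dickmanRho_eq_piece ⟨hv.1.le, by rw [← hum]; exact hv.2⟩
        refine (continuous_dickmanPiece m).continuousWithinAt.congr_of_eventuallyEq this ?_
        rw [hum]; exact dickmanRho_eq_piece ⟨by linarith, le_rfl⟩
    · have : dickmanRho =ᶠ[𝓝[Set.Ici u] u] dickmanPiece n := by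
        have hmem : Set.Ico u ((n : ℝ) + 1) ∈ 𝓝[Set.Ici u] u := Ico_mem_nhdsGE hun
        filter_upwards [hmem] with v hv using dickmanRho_eq_piece ⟨heq.le.trans hv.1, hv.2.le⟩
      refine (continuous_dickmanPiece n).continuousWithinAt.congr_of_eventuallyEq this ?_
      exact dickmanRho_eq_piece ⟨hnu, hun.le⟩

/-! ### The delay-differential equation -/

/-- **Right derivative everywhere on `[1, ∞)`**: `ρ'(u+) = -ρ(u - 1)/u` for `u ≥ 1`.
[cite: MontgomeryVaughan2007, §7.1 (7.6)] -/
theorem hasDerivWithinAt_dickmanRho {u : ℝ} (hu : 1 ≤ u) :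
    HasDerivWithinAt dickmanRho (-(dickmanRho (u - 1) / u)) (Set.Ici u) u := by
  set n : ℕ := ⌊u⌋₊ with hn
  have hu0 : 0 ≤ u := by linarith
  have hnu : (n : ℝ) ≤ u := Nat.floor_le hu0
  have hun : u < n + 1 := Nat.lt_floor_add_one u
  have hn1 : 1 ≤ n := by rw [hn]; exact Nat.le_floor (by exact_mod_cast hu)
  obtain ⟨m, hm⟩ : ∃ m, n = m + 1 := ⟨n - 1, by omega⟩
  have hm' : (n : ℝ) = (m : ℝ) + 1 := by rw [hm]; push_cast; ring
  -- near `u` from the right `ρ = ρ_{m+1}`, and `ρ(u - 1) = ρ_m(u - 1)`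
  have heq : dickmanRho =ᶠ[𝓝[Set.Ici u] u] dickmanPiece (m + 1) := by
    filter_upwards [Ico_mem_nhdsGE hun] with v hv using
      (dickmanRho_eq_piece ⟨hnu.trans hv.1, hv.2.le⟩).trans (by rw [hm])
  have hval : dickmanRho u = dickmanPiece (m + 1) u := (dickmanRho_eq_piece ⟨hnu, hun.le⟩).trans (by rw [hm])
  have hprev : dickmanRho (u - 1) = dickmanPiece m (u - 1) := by
    refine dickmanRho_eq_piece ⟨?_, ?_⟩
    · rw [hm'] at hnu; linarith
    · rw [hm'] at hun; linarith
  have hmax : max u 1 = u := max_eq_left hu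
  have hd := (hasDerivAt_dickmanPiece_succ m u).hasDerivWithinAt (s := Set.Ici u)
  rw [hmax, ← hprev] at hd
  exact hd.congr_of_eventuallyEq heq hval

/-- **The delay-differential equation** at non-integral `u > 1`: `ρ'(u) = -ρ(u - 1)/u`.
[cite: MontgomeryVaughan2007, §7.1 (7.6)] -/
theorem hasDerivAt_dickmanRho {u : ℝ} (hu : 1 < u) (hnot : (⌊u⌋₊ : ℝ) < u) :
    HasDerivAt dickmanRho (-(dickmanRho (u - 1) / u)) u := by
  set n : ℕ := ⌊u⌋₊ with hn
  have hu0 : 0 ≤ u := by linarith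
  have hun : u < n + 1 := Nat.lt_floor_add_one u
  have hn1 : 1 ≤ n := by rw [hn]; exact Nat.le_floor (by exact_mod_cast hu.le)
  obtain ⟨m, hm⟩ : ∃ m, n = m + 1 := ⟨n - 1, by omega⟩
  have hm' : (n : ℝ) = (m : ℝ) + 1 := by rw [hm]; push_cast; ring
  have heq : dickmanRho =ᶠ[𝓝 u] dickmanPiece (m + 1) := by
    filter_upwards [Ioo_mem_nhds hnot hun] with v hv using
      (dickmanRho_eq_piece ⟨hv.1.le, hv.2.le⟩).trans (by rw [hm])
  have hprev : dickmanRho (u - 1) = dickmanPiece m (u - 1) := by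
    refine dickmanRho_eq_piece ⟨?_, ?_⟩
    · rw [hm'] at hnot; linarith
    · rw [hm'] at hun; linarith
  have hmax : max u 1 = u := max_eq_left hu.le
  have hd := hasDerivAt_dickmanPiece_succ m u
  rw [hmax, ← hprev] at hd
  exact hd.congr_of_eventuallyEq heq

/-! ### The averaged equation `u ρ(u) = ∫_{u-1}^u ρ` -/

/-- `w ↦ ∫_{w-1}^w ρ` as a difference of primitives. [folklore] -/
theorem intervalIntegral_dickmanRho_eq_sub (w : ℝ) :
    ∫ t in (w - 1)..w, dickmanRho t = (∫ t in (0 : ℝ)..w, dickmanRho t) - ∫ t in (0 : ℝ)..(w - 1), dickmanRho t := by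
  rw [eq_sub_iff_add_eq, add_comm,
    intervalIntegral.integral_add_adjacent_intervals (continuous_dickmanRho.intervalIntegrable _ _)
      (continuous_dickmanRho.intervalIntegrable _ _)]

/-- `d/dw ∫_{w-1}^w ρ = ρ(w) - ρ(w - 1)`. [folklore] -/
theorem hasDerivAt_intervalIntegral_dickmanRho (w : ℝ) :
    HasDerivAt (fun w : ℝ => ∫ t in (w - 1)..w, dickmanRho t) (dickmanRho w - dickmanRho (w - 1)) w := by
  have hP : ∀ v, HasDerivAt (fun w : ℝ => ∫ t in (0 : ℝ)..w, dickmanRho t) (dickmanRho v) v := fun v =>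
    (continuous_dickmanRho.integral_hasStrictDerivAt 0 v).hasDerivAt
  have heq : (fun w : ℝ => ∫ t in (w - 1)..w, dickmanRho t) =
      fun w => (∫ t in (0 : ℝ)..w, dickmanRho t) - ∫ t in (0 : ℝ)..(w - 1), dickmanRho t :=
    funext intervalIntegral_dickmanRho_eq_sub
  rw [heq]
  have h3 : HasDerivAt (fun w : ℝ => ∫ t in (0 : ℝ)..(w - 1), dickmanRho t) (dickmanRho (w - 1)) w := by
    have := (hP (w - 1)).comp w ((hasDerivAt_id w).sub_const 1)
    simpa [Function.comp_def] using this
  exact (hP w).sub h3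

/-- **The averaged Dickman equation**: `u ρ(u) = ∫_{u-1}^u ρ(t) dt` for `u ≥ 1`. (Both sides are continuous,
agree at `u = 1`, and have the same right derivative `ρ(u) - ρ(u-1)` on `[1, ∞)`.)
[cite: MontgomeryVaughan2007, §7.1 (integrating (7.6))] -/
theorem mul_dickmanRho_eq_integral {u : ℝ} (hu : 1 ≤ u) : u * dickmanRho u = ∫ t in (u - 1)..u, dickmanRho t := by
  set G : ℝ → ℝ := fun w => w * dickmanRho w - ∫ t in (w - 1)..w, dickmanRho t with hG
  have hcont : Continuous G := by
    refine (continuous_id.mul continuous_dickmanRho).sub ?_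
    have hP : Continuous fun w : ℝ => ∫ t in (0 : ℝ)..w, dickmanRho t :=
      intervalIntegral.continuous_primitive (fun a b => continuous_dickmanRho.intervalIntegrable (μ := volume) a b) 0
    rw [show (fun w : ℝ => ∫ t in (w - 1)..w, dickmanRho t) =
      fun w => (∫ t in (0 : ℝ)..w, dickmanRho t) - ∫ t in (0 : ℝ)..(w - 1), dickmanRho t from
        funext intervalIntegral_dickmanRho_eq_sub]
    exact hP.sub (hP.comp (continuous_sub_right 1))
  have hderiv : ∀ w ∈ Set.Ico (1 : ℝ) u, HasDerivWithinAt G 0 (Set.Ici w) w := by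
    intro w hw
    have hw1 : 1 ≤ w := hw.1
    have h1 : HasDerivWithinAt (fun w => w * dickmanRho w) (1 * dickmanRho w + w * (-(dickmanRho (w - 1) / w)))
        (Set.Ici w) w := (hasDerivWithinAt_id w _).mul (hasDerivWithinAt_dickmanRho hw1)
    have h := h1.sub (hasDerivAt_intervalIntegral_dickmanRho w).hasDerivWithinAt
    have hw0 : w ≠ 0 := by linarith
    have hval : 1 * dickmanRho w + w * -(dickmanRho (w - 1) / w) - (dickmanRho w - dickmanRho (w - 1)) = 0 := by
      field_simp; ring
    have h' : HasDerivWithinAt G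
        (1 * dickmanRho w + w * -(dickmanRho (w - 1) / w) - (dickmanRho w - dickmanRho (w - 1))) (Set.Ici w) w := h
    rwa [hval] at h'
  have hconst := constant_of_has_deriv_right_zero (hcont.continuousOn (s := Set.Icc 1 u)) hderiv u ⟨hu, le_rfl⟩
  have hG1 : G 1 = 0 := by
    have hint : ∫ t in (0 : ℝ)..1, dickmanRho t = 1 := by
      rw [intervalIntegral.integral_congr (g := fun _ => (1 : ℝ)) (fun t ht => ?_)]
      · simp
      · rw [Set.uIcc_of_le zero_le_one] at ht
        exact dickmanRho_of_le_one ht.2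
    simp only [hG, sub_self, hint, dickmanRho_one, mul_one]
  have : G u = 0 := hconst.trans hG1
  simp only [hG] at this
  linarith

/-! ### `ρ = 1 - log u` on `[1, 2]` -/

/-- `ρ(u) = 1 - log u` for `1 ≤ u ≤ 2`. [cite: MontgomeryVaughan2007, §7.1 (7.10)] -/
theorem dickmanRho_eq_one_sub_log {u : ℝ} (hu : u ∈ Set.Icc (1 : ℝ) 2) : dickmanRho u = 1 - Real.log u := by
  have h1 : dickmanRho u = dickmanPiece 1 u := dickmanRho_eq_piece (n := 1) ⟨by simpa using hu.1, by norm_num; exact hu.2⟩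
  rw [h1, show (1 : ℕ) = 0 + 1 from rfl, dickmanPiece_succ]
  simp only [Nat.cast_zero, zero_add, dickmanPiece_zero]
  have hint : ∫ v in (1 : ℝ)..u, (1 : ℝ) / max v 1 = Real.log u := by
    rw [intervalIntegral.integral_congr (g := fun v => v⁻¹) (fun v hv => ?_)]
    · rw [integral_inv_of_pos zero_lt_one (by linarith [hu.1]), div_one]
    · rw [Set.uIcc_of_le hu.1] at hv
      simp [max_eq_left hv.1]
  rw [hint]

/-- `ρ(3/2) = 1 - log(3/2) ≥ 1/2`. [folklore] -/
theorem half_le_dickmanRho_three_halves : 1 / 2 ≤ dickmanRho (3 / 2) := by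
  rw [dickmanRho_eq_one_sub_log ⟨by norm_num, by norm_num⟩]
  have h : Real.log (3 / 2) ≤ 1 / 2 := by
    have h1 : Real.log (3 / 2) ≤ 3 / 2 - 1 := Real.log_le_sub_one_of_pos (by norm_num)
    linarith
  linarith

/-! ### Positivity and monotonicity -/

/-- On `[k, k+1]`, if `ρ ≥ 0` on `[k-1, k]` then `ρ` is non-increasing on `[k, k+1]`. [folklore] -/
theorem dickmanRho_antitoneOn_step {k : ℕ} (hk : 1 ≤ k) (hpos : ∀ t ∈ Set.Icc ((k : ℝ) - 1) k, 0 ≤ dickmanRho t) :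
    AntitoneOn dickmanRho (Set.Icc (k : ℝ) (k + 1)) := by
  have hk1 : (1 : ℝ) ≤ k := by exact_mod_cast hk
  refine antitoneOn_of_deriv_nonpos (convex_Icc _ _) continuous_dickmanRho.continuousOn (fun u hu => ?_)
    (fun u hu => ?_)
  · rw [interior_Icc] at hu
    have hfl : (⌊u⌋₊ : ℝ) = k := by
      rw [(Nat.floor_eq_iff (by linarith [hu.1])).2 ⟨hu.1.le, hu.2⟩]
    exact (hasDerivAt_dickmanRho (by linarith [hu.1]) (by rw [hfl]; exact hu.1)).differentiableAt.differentiableWithinAt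
  · rw [interior_Icc] at hu
    have hfl : (⌊u⌋₊ : ℝ) = k := by
      rw [(Nat.floor_eq_iff (by linarith [hu.1])).2 ⟨hu.1.le, hu.2⟩]
    rw [(hasDerivAt_dickmanRho (by linarith [hu.1]) (by rw [hfl]; exact hu.1)).deriv]
    have h0 : 0 ≤ dickmanRho (u - 1) := hpos _ ⟨by linarith [hu.1], by linarith [hu.2]⟩
    have hu0 : 0 < u := by linarith [hu.1]
    have : 0 ≤ dickmanRho (u - 1) / u := div_nonneg h0 hu0.le
    linarith

/-- **Positivity and monotonicity, inductively**: `ρ > 0` on `[0, k]` and `ρ` is non-increasing on `[0, k]`.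
[cite: MontgomeryVaughan2007, §7.1] -/
theorem dickmanRho_pos_antitoneOn_Icc : ∀ k : ℕ, 1 ≤ k →
    (∀ t ∈ Set.Icc (0 : ℝ) k, 0 < dickmanRho t) ∧ AntitoneOn dickmanRho (Set.Icc (0 : ℝ) k) := by
  intro k hk
  induction k, hk using Nat.le_induction with
  | base =>
    refine ⟨fun t ht => ?_, fun a ha b hb _ => ?_⟩
    · rw [dickmanRho_of_le_one (by simpa using ht.2)]; exact one_pos
    · rw [dickmanRho_of_le_one (u := b) (by simpa using hb.2), dickmanRho_of_le_one (u := a) (by simpa using ha.2)]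
  | succ k hk IH =>
    obtain ⟨hpos, hanti⟩ := IH
    have hk1 : (1 : ℝ) ≤ k := by exact_mod_cast hk
    push_cast
    -- monotonicity on the new interval, then on `[0, k+1]`
    have hstep : AntitoneOn dickmanRho (Set.Icc (k : ℝ) (k + 1)) :=
      dickmanRho_antitoneOn_step hk fun t ht => (hpos t ⟨by linarith [ht.1], ht.2⟩).le
    have hanti' : AntitoneOn dickmanRho (Set.Icc (0 : ℝ) (k + 1)) := by
      intro a ha b hb hab
      rcases le_total b k with hbk | hbk
      · exact hanti ⟨ha.1, hab.trans hbk⟩ ⟨hb.1, hbk⟩ hab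
      rcases le_total a k with hak | hak
      · exact (hstep ⟨le_rfl, by linarith⟩ ⟨hbk, hb.2⟩ hbk).trans (hanti ⟨ha.1, hak⟩ ⟨by linarith, le_rfl⟩ hak)
      · exact hstep ⟨hak, ha.2⟩ ⟨hbk, hb.2⟩ hab
    refine ⟨fun t ht => ?_, hanti'⟩
    rcases le_or_gt t k with htk | htk
    · exact hpos t ⟨ht.1, htk⟩
    -- positivity on `(k, k+1]`: the least zero `z` of `ρ` on `[k, k+1]` would have `z ρ(z) = ∫_{z-1}^z ρ > 0`
    by_contra hneg
    push Not at hneg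
    -- a zero exists in `[k, t]` by the intermediate value theorem
    set Z : Set ℝ := {z ∈ Set.Icc (k : ℝ) (k + 1) | dickmanRho z = 0} with hZ
    have hZne : Z.Nonempty := by
      have hkpos : 0 < dickmanRho k := hpos k ⟨by linarith, le_rfl⟩
      have hivt := intermediate_value_Icc' htk.le continuous_dickmanRho.continuousOn
      obtain ⟨z, hz, hz0⟩ := hivt ⟨hneg, hkpos.le⟩
      exact ⟨z, ⟨hz.1, hz.2.trans ht.2⟩, hz0⟩
    have hZc : IsCompact Z := by
      have : Z = Set.Icc (k : ℝ) (k + 1) ∩ dickmanRho ⁻¹' {0} := by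
        ext z; simp [hZ]
      rw [this]
      exact isCompact_Icc.inter_right (isClosed_singleton.preimage continuous_dickmanRho)
    obtain ⟨z, ⟨⟨hzk, hzk1⟩, hz0⟩, hzleast⟩ := hZc.exists_isLeast hZne
    -- `ρ > 0` on `[z-1, z)`
    have hkz : (k : ℝ) < z := by
      rcases hzk.lt_or_eq with h | h
      · exact h
      · exfalso; have := hpos k ⟨by linarith, le_rfl⟩; rw [h, hz0] at this; exact lt_irrefl _ this
    have hposz : ∀ s ∈ Set.Ioo (z - 1) z, 0 < dickmanRho s := by
      intro s hs
      rcases le_or_gt s k with hsk | hsk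
      · exact hpos s ⟨by linarith [hs.1], hsk⟩
      · -- `k < s < z`: if `ρ s ≤ 0`, a zero in `[k, s]` would lie below `z`
        by_contra hs0
        push Not at hs0
        have hkpos : 0 < dickmanRho k := hpos k ⟨by linarith, le_rfl⟩
        obtain ⟨z', hz', hz'0⟩ := intermediate_value_Icc' hsk.le continuous_dickmanRho.continuousOn ⟨hs0, hkpos.le⟩
        have hz'Z : z' ∈ Z := ⟨⟨hz'.1, hz'.2.trans (hs.2.le.trans hzk1)⟩, hz'0⟩
        have := hzleast hz'Z
        linarith [hz'.2, hs.2]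
    have hz1 : 1 ≤ z := by linarith
    have hint : 0 < ∫ s in (z - 1)..z, dickmanRho s :=
      intervalIntegral.intervalIntegral_pos_of_pos_on (continuous_dickmanRho.intervalIntegrable _ _) hposz (by linarith)
    rw [← mul_dickmanRho_eq_integral hz1, hz0, mul_zero] at hint
    exact lt_irrefl _ hint

/-- **`ρ > 0`.** [cite: MontgomeryVaughan2007, §7.1] -/
theorem dickmanRho_pos (u : ℝ) : 0 < dickmanRho u := by
  rcases le_or_gt u 1 with hu | hu
  · rw [dickmanRho_of_le_one hu]; exact one_pos
  · have hk : 1 ≤ ⌈u⌉₊ := Nat.ceil_pos.2 (by linarith)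
    exact (dickmanRho_pos_antitoneOn_Icc ⌈u⌉₊ hk).1 u ⟨by linarith, Nat.le_ceil u⟩

/-- `ρ ≥ 0`. [folklore] -/
theorem dickmanRho_nonneg (u : ℝ) : 0 ≤ dickmanRho u := (dickmanRho_pos u).le

/-- **`ρ` is non-increasing** (on all of `ℝ`, with the convention `ρ = 1` on `(-∞, 1]`).
[cite: MontgomeryVaughan2007, §7.1] -/
theorem dickmanRho_antitone : Antitone dickmanRho := by
  intro a b hab
  rcases le_or_gt b 1 with hb | hb
  · rw [dickmanRho_of_le_one hb, dickmanRho_of_le_one (hab.trans hb)]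
  have hk : 1 ≤ ⌈b⌉₊ := Nat.ceil_pos.2 (by linarith)
  have hanti := (dickmanRho_pos_antitoneOn_Icc ⌈b⌉₊ hk).2
  rcases le_or_gt a 1 with ha | ha
  · rw [dickmanRho_of_le_one ha, ← dickmanRho_one]
    exact hanti ⟨zero_le_one, by exact_mod_cast hk⟩ ⟨by linarith, Nat.le_ceil b⟩ hb.le
  · exact hanti ⟨by linarith, hab.trans (Nat.le_ceil b)⟩ ⟨by linarith, Nat.le_ceil b⟩ hab

/-- `ρ ≤ 1`. [cite: MontgomeryVaughan2007, §7.1] -/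
theorem dickmanRho_le_one (u : ℝ) : dickmanRho u ≤ 1 := by
  rcases le_or_gt u 1 with hu | hu
  · rw [dickmanRho_of_le_one hu]
  · rw [← dickmanRho_one]; exact dickmanRho_antitone hu.le

/-! ### Crude local bounds: `ρ(u - 1) ≤ 4u² ρ(u)` -/

/-- `ρ(u - 1/2) ≤ 2u ρ(u)` for `u ≥ 1` (`u ρ(u) = ∫_{u-1}^u ρ ≥ ∫_{u-1}^{u-1/2} ρ ≥ ρ(u - 1/2)/2`). [folklore] -/
theorem dickmanRho_sub_half_le {u : ℝ} (hu : 1 ≤ u) : dickmanRho (u - 1 / 2) ≤ 2 * u * dickmanRho u := by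
  have hsplit : ∫ t in (u - 1)..u, dickmanRho t =
      (∫ t in (u - 1)..(u - 1 / 2), dickmanRho t) + ∫ t in (u - 1 / 2)..u, dickmanRho t :=
    (intervalIntegral.integral_add_adjacent_intervals (continuous_dickmanRho.intervalIntegrable _ _)
      (continuous_dickmanRho.intervalIntegrable _ _)).symm
  have h1 : 1 / 2 * dickmanRho (u - 1 / 2) ≤ ∫ t in (u - 1)..(u - 1 / 2), dickmanRho t := by
    have hc : ∫ _ in (u - 1)..(u - 1 / 2), dickmanRho (u - 1 / 2) = 1 / 2 * dickmanRho (u - 1 / 2) := by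
      rw [intervalIntegral.integral_const, smul_eq_mul]; ring
    rw [← hc]
    refine intervalIntegral.integral_mono_on (by linarith) (by simp) (continuous_dickmanRho.intervalIntegrable _ _)
      fun t ht => dickmanRho_antitone ht.2
  have h2 : 0 ≤ ∫ t in (u - 1 / 2)..u, dickmanRho t :=
    intervalIntegral.integral_nonneg (by linarith) fun t _ => dickmanRho_nonneg t
  have h3 := mul_dickmanRho_eq_integral hu
  linarith

/-- **`ρ(u - 1) ≤ 4u² ρ(u)` for `u ≥ 1`** (twice `dickmanRho_sub_half_le`; for `u < 3/2` directly from
`ρ(3/2) ≥ 1/2`). [folklore] -/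
theorem dickmanRho_sub_one_le {u : ℝ} (hu : 1 ≤ u) : dickmanRho (u - 1) ≤ 4 * u ^ 2 * dickmanRho u := by
  rcases le_or_gt (3 / 2) u with h32 | h32
  · have h1 : dickmanRho (u - 1) ≤ 2 * (u - 1 / 2) * dickmanRho (u - 1 / 2) := by
      have := dickmanRho_sub_half_le (u := u - 1 / 2) (by linarith)
      rwa [show u - 1 / 2 - 1 / 2 = u - 1 by ring] at this
    have h2 := dickmanRho_sub_half_le hu
    have h3 : 0 ≤ dickmanRho (u - 1 / 2) := dickmanRho_nonneg _
    have h4 : 2 * (u - 1 / 2) * dickmanRho (u - 1 / 2) ≤ 2 * u * dickmanRho (u - 1 / 2) := by nlinarith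
    calc dickmanRho (u - 1) ≤ 2 * u * dickmanRho (u - 1 / 2) := h1.trans h4
      _ ≤ 2 * u * (2 * u * dickmanRho u) := mul_le_mul_of_nonneg_left h2 (by linarith)
      _ = 4 * u ^ 2 * dickmanRho u := by ring
  · have h1 : dickmanRho (u - 1) = 1 := dickmanRho_of_le_one (by linarith)
    have h2 : dickmanRho (3 / 2) ≤ dickmanRho u := dickmanRho_antitone h32.le
    have h3 := half_le_dickmanRho_three_halves
    have h4 : 1 ≤ u ^ 2 := by nlinarith
    rw [h1]
    nlinarith

/-! ### The function `g(s) = (e^s - 1)/s` and de Bruijn's `ξ(u)` -/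

/-- `g(s) = (e^s - 1)/s` (and `g(0) = 1`). [cite: HildebrandTenenbaum1986, Thm 2 (ii): `e^ξ = 1 + uξ`] -/
def expSubOneDiv (s : ℝ) : ℝ := if s = 0 then 1 else (Real.exp s - 1) / s

/-- `g(s) = (e^s - 1)/s` for `s ≠ 0`. [folklore] -/
theorem expSubOneDiv_of_ne_zero {s : ℝ} (hs : s ≠ 0) : expSubOneDiv s = (Real.exp s - 1) / s := if_neg hs

/-- `g` agrees with `(e^s - 1)/s` on `(0, ∞)`. [folklore] -/
theorem expSubOneDiv_eqOn : Set.EqOn expSubOneDiv (fun s => (Real.exp s - 1) / s) (Set.Ioi 0) :=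
  fun _ hs => expSubOneDiv_of_ne_zero (ne_of_gt hs)

/-- `g` is continuous on `(0, ∞)`. [folklore] -/
theorem continuousOn_expSubOneDiv : ContinuousOn expSubOneDiv (Set.Ioi 0) := by
  refine ContinuousOn.congr (f := fun s => (Real.exp s - 1) / s) ?_ expSubOneDiv_eqOn
  exact ContinuousOn.div (by fun_prop) continuousOn_id fun s hs => ne_of_gt hs

/-- `g'(s) = (s e^s - e^s + 1)/s²` for `s ≠ 0`. [folklore] -/
theorem hasDerivAt_expSubOneDiv {s : ℝ} (hs : 0 < s) :
    HasDerivAt expSubOneDiv ((s * Real.exp s - Real.exp s + 1) / s ^ 2) s := by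
  have h1 : HasDerivAt (fun s => (Real.exp s - 1) / s) (((Real.exp s) * s - (Real.exp s - 1) * 1) / s ^ 2) s :=
    ((Real.hasDerivAt_exp s).sub_const 1).div (hasDerivAt_id s) (ne_of_gt hs)
  have heq : expSubOneDiv =ᶠ[𝓝 s] fun s => (Real.exp s - 1) / s := by
    filter_upwards [Ioi_mem_nhds hs] with t ht using expSubOneDiv_of_ne_zero (ne_of_gt ht)
  rw [show (s * Real.exp s - Real.exp s + 1) / s ^ 2 = ((Real.exp s) * s - (Real.exp s - 1) * 1) / s ^ 2 by ring]
  exact h1.congr_of_eventuallyEq heq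

/-- `s e^s - e^s + 1 ≥ s²/2` for `s ≥ 0` (the derivative of the difference is `s(e^s - 1) ≥ 0`). [folklore] -/
theorem half_sq_le_mul_exp_sub (s : ℝ) (hs : 0 ≤ s) : s ^ 2 / 2 ≤ s * Real.exp s - Real.exp s + 1 := by
  -- `k(s) = s e^s - e^s + 1 - s²/2` is non-decreasing on `[0, ∞)` and `k(0) = 0`
  set k : ℝ → ℝ := fun s => s * Real.exp s - Real.exp s + 1 - s * s / 2 with hk
  have hderiv : ∀ x, HasDerivAt k (x * (Real.exp x - 1)) x := by
    intro x
    have h1 : HasDerivAt (fun s => s * Real.exp s) (1 * Real.exp x + x * Real.exp x) x :=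
      (hasDerivAt_id x).mul (Real.hasDerivAt_exp x)
    have h2 : HasDerivAt (fun s : ℝ => s * s / 2) ((1 * x + x * 1) / 2) x :=
      ((hasDerivAt_id x).mul (hasDerivAt_id x)).div_const 2
    have h := ((h1.sub (Real.hasDerivAt_exp x)).add_const 1).sub h2
    exact h.congr_deriv (by ring)
  have hmono : MonotoneOn k (Set.Ici 0) := by
    refine monotoneOn_of_deriv_nonneg (convex_Ici 0) (fun x _ => (hderiv x).continuousAt.continuousWithinAt)
      (fun x _ => (hderiv x).differentiableAt.differentiableWithinAt) fun x hx => ?_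
    rw [interior_Ici] at hx
    have hx' : 0 < x := hx
    rw [(hderiv x).deriv]
    exact mul_nonneg hx'.le (by linarith [Real.add_one_le_exp x])
  have h0 : k 0 = 0 := by simp [hk]
  have := hmono Set.self_mem_Ici hs hs
  rw [h0] at this
  simp only [hk] at this
  nlinarith [this]

/-- `g' ≥ 1/2` on `(0, ∞)`. [folklore] -/
theorem half_le_deriv_expSubOneDiv {s : ℝ} (hs : 0 < s) : 1 / 2 ≤ deriv expSubOneDiv s := by
  rw [(hasDerivAt_expSubOneDiv hs).deriv, le_div_iff₀ (by positivity)]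
  have := half_sq_le_mul_exp_sub s hs.le
  linarith

/-- `g` is strictly increasing on `(0, ∞)`. [folklore] -/
theorem strictMonoOn_expSubOneDiv : StrictMonoOn expSubOneDiv (Set.Ioi 0) := by
  refine strictMonoOn_of_deriv_pos (convex_Ioi 0) continuousOn_expSubOneDiv fun s hs => ?_
  rw [interior_Ioi] at hs
  linarith [half_le_deriv_expSubOneDiv hs]

/-- **Inverse Lipschitz bound**: `b - a ≤ 2 (g(b) - g(a))` for `0 < a ≤ b`. [folklore] -/
theorem sub_le_two_mul_sub_expSubOneDiv {a b : ℝ} (ha : 0 < a) (hab : a ≤ b) :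
    b - a ≤ 2 * (expSubOneDiv b - expSubOneDiv a) := by
  have hcont : ContinuousOn expSubOneDiv (Set.Icc a b) := continuousOn_expSubOneDiv.mono fun x hx => ha.trans_le hx.1
  have hdiff : DifferentiableOn ℝ expSubOneDiv (interior (Set.Icc a b)) := by
    rw [interior_Icc]
    exact fun x hx => (hasDerivAt_expSubOneDiv (ha.trans hx.1)).differentiableAt.differentiableWithinAt
  have h := (convex_Icc a b).mul_sub_le_image_sub_of_le_deriv hcont hdiff (C := 1 / 2)
    (fun x hx => by rw [interior_Icc] at hx; exact half_le_deriv_expSubOneDiv (ha.trans hx.1))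
    a ⟨le_rfl, hab⟩ b ⟨hab, le_rfl⟩ hab
  linarith

/-- `g(s) ≤ e^s` for `s > 0`. [folklore] -/
theorem expSubOneDiv_le_exp {s : ℝ} (hs : 0 < s) : expSubOneDiv s ≤ Real.exp s := by
  rw [expSubOneDiv_of_ne_zero hs.ne', div_le_iff₀ hs]
  have := half_sq_le_mul_exp_sub s hs.le
  nlinarith [sq_nonneg s]

/-- `g(s) ≥ 1 + s/2` for `s > 0`. [folklore] -/
theorem one_add_half_le_expSubOneDiv {s : ℝ} (hs : 0 < s) : 1 + s / 2 ≤ expSubOneDiv s := by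
  rw [expSubOneDiv_of_ne_zero hs.ne', le_div_iff₀ hs]
  -- `e^s - 1 ≥ s + s²/2`
  have h1 : s * Real.exp s - Real.exp s + 1 ≥ s ^ 2 / 2 := half_sq_le_mul_exp_sub s hs.le
  have h2 : 1 - Real.exp (-s) ≤ s := by have := Real.add_one_le_exp (-s); linarith
  -- from `e^s ≥ 1 + s + s²/2`: use the series bound via `k`: `e^s - 1 - s = ∫ ...`; simpler: `quadratic_le_exp`
  have h3 : 1 + s + s ^ 2 / 2 ≤ Real.exp s := by
    have := Real.quadratic_le_exp_of_nonneg hs.le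
    linarith
  nlinarith

/-- Existence of de Bruijn's `ξ(u)`: for `u > 1` some `s > 0` has `g(s) = u`. [cite: HildebrandTenenbaum1986, Thm 2 (ii)] -/
theorem exists_expSubOneDiv_eq {u : ℝ} (hu : 1 < u) : ∃ s, 0 < s ∧ expSubOneDiv s = u := by
  set s₁ : ℝ := Real.log u / 2 with hs₁
  set s₂ : ℝ := 2 * u with hs₂
  have hs₁0 : 0 < s₁ := by rw [hs₁]; exact div_pos (Real.log_pos hu) two_pos
  have hg1 : expSubOneDiv s₁ ≤ u := by
    refine (expSubOneDiv_le_exp hs₁0).trans ?_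
    have : Real.exp s₁ ≤ Real.exp (Real.log u) := Real.exp_le_exp.2 (by rw [hs₁]; linarith [Real.log_pos hu])
    rwa [Real.exp_log (by linarith)] at this
  have hg2 : u ≤ expSubOneDiv s₂ := by
    have := one_add_half_le_expSubOneDiv (s := s₂) (by rw [hs₂]; linarith)
    rw [hs₂] at this ⊢; linarith
  have h12 : s₁ ≤ s₂ := by
    rw [hs₁, hs₂]; have := Real.log_le_sub_one_of_pos (by linarith : 0 < u); linarith
  have hcont : ContinuousOn expSubOneDiv (Set.Icc s₁ s₂) := continuousOn_expSubOneDiv.mono fun x hx => hs₁0.trans_le hx.1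
  obtain ⟨s, hs, hsu⟩ := intermediate_value_Icc h12 hcont ⟨hg1, hg2⟩
  exact ⟨s, hs₁0.trans_le hs.1, hsu⟩

/-- **De Bruijn's `ξ(u)`**: the unique positive solution of `e^ξ = 1 + uξ` (`u > 1`); `0` for `u ≤ 1`.
[cite: HildebrandTenenbaum1986, Thm 2 (ii)] -/
def dickmanXi (u : ℝ) : ℝ := if hu : 1 < u then Classical.choose (exists_expSubOneDiv_eq hu) else 0

/-- `ξ(u) > 0` for `u > 1`. [cite: HildebrandTenenbaum1986, Thm 2 (ii)] -/
theorem dickmanXi_pos {u : ℝ} (hu : 1 < u) : 0 < dickmanXi u := by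
  rw [dickmanXi, dif_pos hu]; exact (Classical.choose_spec (exists_expSubOneDiv_eq hu)).1

/-- `g(ξ(u)) = u` for `u > 1`. [cite: HildebrandTenenbaum1986, Thm 2 (ii)] -/
theorem expSubOneDiv_dickmanXi {u : ℝ} (hu : 1 < u) : expSubOneDiv (dickmanXi u) = u := by
  rw [dickmanXi, dif_pos hu]; exact (Classical.choose_spec (exists_expSubOneDiv_eq hu)).2

/-- The convention `ξ(u) = 0` for `u ≤ 1`. [folklore] -/
theorem dickmanXi_of_le_one {u : ℝ} (hu : u ≤ 1) : dickmanXi u = 0 := by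
  rw [dickmanXi, dif_neg (not_lt.2 hu)]

/-- **The defining equation** `e^{ξ(u)} = 1 + u ξ(u)` (`u > 1`). [cite: HildebrandTenenbaum1986, Thm 2 (ii)] -/
theorem exp_dickmanXi {u : ℝ} (hu : 1 < u) : Real.exp (dickmanXi u) = 1 + u * dickmanXi u := by
  have h := expSubOneDiv_dickmanXi hu
  have hξ := dickmanXi_pos hu
  rw [expSubOneDiv_of_ne_zero hξ.ne', div_eq_iff hξ.ne'] at h
  linarith

/-- Uniqueness: a positive `s` with `g(s) = u` is `ξ(u)`. [folklore] -/
theorem eq_dickmanXi_of_expSubOneDiv_eq {u s : ℝ} (hu : 1 < u) (hs : 0 < s) (h : expSubOneDiv s = u) :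
    s = dickmanXi u :=
  strictMonoOn_expSubOneDiv.injOn hs (dickmanXi_pos hu) (h.trans (expSubOneDiv_dickmanXi hu).symm)

/-- **Stability of `ξ`**: `|s - ξ(u)| ≤ 2 |g(s) - u|` for `s > 0`, `u > 1`. [folklore] -/
theorem abs_sub_dickmanXi_le {u s : ℝ} (hu : 1 < u) (hs : 0 < s) : |s - dickmanXi u| ≤ 2 * |expSubOneDiv s - u| := by
  have hξ := dickmanXi_pos hu
  have hgt := expSubOneDiv_dickmanXi hu
  set t : ℝ := dickmanXi u with ht
  rw [← hgt]
  rcases le_total s t with h | h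
  · have h1 := sub_le_two_mul_sub_expSubOneDiv hs h
    have h2 : expSubOneDiv s ≤ expSubOneDiv t := strictMonoOn_expSubOneDiv.monotoneOn hs hξ h
    rw [abs_of_nonpos (by linarith), abs_of_nonpos (by linarith)]
    linarith
  · have h1 := sub_le_two_mul_sub_expSubOneDiv hξ h
    have h2 : expSubOneDiv t ≤ expSubOneDiv s := strictMonoOn_expSubOneDiv.monotoneOn hξ hs h
    rw [abs_of_nonneg (by linarith), abs_of_nonneg (by linarith)]
    linarith

/-- `ξ` is non-decreasing on `(1, ∞)`. [folklore] -/
theorem dickmanXi_le_dickmanXi {u v : ℝ} (hu : 1 < u) (huv : u ≤ v) : dickmanXi u ≤ dickmanXi v := by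
  have hv : 1 < v := hu.trans_le huv
  by_contra h
  push Not at h
  have := strictMonoOn_expSubOneDiv (dickmanXi_pos hv) (dickmanXi_pos hu) h
  rw [expSubOneDiv_dickmanXi hu, expSubOneDiv_dickmanXi hv] at this
  linarith

/-- `ξ(u) > log u` for `u ≥ 2` (`e^ξ = 1 + uξ > uξ ≥ u` once `ξ ≥ 1`, i.e. `u ≥ e - 1`). [folklore] -/
theorem log_lt_dickmanXi {u : ℝ} (hu : 2 ≤ u) : Real.log u < dickmanXi u := by
  have hu1 : 1 < u := by linarith
  have hξ := dickmanXi_pos hu1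
  -- `ξ ≥ 1`: otherwise `u = g(ξ) < g(1) = e - 1 < 2`
  have hξ1 : 1 ≤ dickmanXi u := by
    by_contra h
    push Not at h
    have h1 := strictMonoOn_expSubOneDiv hξ (show (0 : ℝ) < 1 by norm_num) h
    rw [expSubOneDiv_dickmanXi hu1, expSubOneDiv_of_ne_zero one_ne_zero, div_one] at h1
    have := Real.exp_one_lt_d9
    linarith
  have hexp := exp_dickmanXi hu1
  rw [Real.log_lt_iff_lt_exp (by linarith), hexp]
  nlinarith

/-- `ξ(u) ≤ 2 log u` for `u ≥ 16` (`g(2 log u) = (u² - 1)/(2 log u) ≥ u`, by `log u ≤ 2(√u - 1)`). [folklore] -/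
theorem dickmanXi_le_two_mul_log {u : ℝ} (hu : 16 ≤ u) : dickmanXi u ≤ 2 * Real.log u := by
  have hu1 : 1 < u := by linarith
  have hlog0 : 0 < Real.log u := Real.log_pos hu1
  -- it suffices that `g(2 log u) ≥ u = g(ξ)`
  by_contra h
  push Not at h
  have hmono := strictMonoOn_expSubOneDiv (show (0 : ℝ) < 2 * Real.log u by positivity) (dickmanXi_pos hu1) h
  rw [expSubOneDiv_dickmanXi hu1, expSubOneDiv_of_ne_zero (by positivity),
    show Real.exp (2 * Real.log u) = u ^ 2 by rw [mul_comm, Real.exp_mul, Real.exp_log (by linarith)]; norm_num,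
    div_lt_iff₀ (by positivity)] at hmono
  -- `u² - 1 < 2 u log u` contradicts `log u ≤ 2√u - 2` and `u ≥ 16`
  have hsqrt : Real.log u ≤ 2 * Real.sqrt u - 2 := by
    have h1 : Real.log (Real.sqrt u) ≤ Real.sqrt u - 1 := Real.log_le_sub_one_of_pos (Real.sqrt_pos.2 (by linarith))
    rw [Real.log_sqrt (by linarith)] at h1
    linarith
  have hs4 : 4 ≤ Real.sqrt u := by
    rw [show (4 : ℝ) = Real.sqrt 16 by rw [show (16 : ℝ) = 4 ^ 2 by norm_num, Real.sqrt_sq (by norm_num)]]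
    exact Real.sqrt_le_sqrt hu
  have hsq : Real.sqrt u * Real.sqrt u = u := Real.mul_self_sqrt (by linarith)
  have hu0 : 0 ≤ u := by linarith
  have k1 : u * (2 * Real.log u) ≤ 4 * (u * Real.sqrt u) - 4 * u := by
    have := mul_le_mul_of_nonneg_left hsqrt hu0
    linarith
  have k2 : 4 * (u * Real.sqrt u) ≤ u * u := by
    have := mul_le_mul_of_nonneg_left hs4 (by positivity : (0 : ℝ) ≤ u * Real.sqrt u)
    calc 4 * (u * Real.sqrt u) = u * Real.sqrt u * 4 := by ring
      _ ≤ u * Real.sqrt u * Real.sqrt u := this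
      _ = u * (Real.sqrt u * Real.sqrt u) := by ring
      _ = u * u := by rw [hsq]
  nlinarith [k1, k2, hmono]

end Literature.NumberTheory.Sieve

end
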